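import Mathlib
import Literature.NumberTheory.Transcendental.KZIdealTetrahedron
import Literature.NumberTheory.Transcendental.KZCalculusProofs
import Literature.NumberTheory.Transcendental.SemialgebraicMapsProofs

/-!
# `OffTetraSectorKernel`, line `flat-shadow`: inverting the height (stub `stub_invert`)

Stub `stub_invert` of the crux `OffTetraSectorKernel` (stmt-KontsevichZagierPeriods-10557, route
HyperbolicBloch). In the upper half-space `ℝ³` (coordinates `p 0 = x`, `p 1 = y`, `p 2 = t`) the
height inversion `Φ(x, y, t) = (x, y, 1/t)` is an involution of `{t ≠ 0}`; on the ideal tetrahedron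
`T(z) = idealTetrahedron z ⊆ {t > 0}` it is a `ℚ`-semialgebraic injective map (coordinates are
quotients of rational polynomials, denominator `t ≠ 0`) with derivative `diag(1, 1, −1/t²)` of
determinant `−1/t²`, and it maps `T(z)` ONTO the inverted solid
`S(z) = {q ∈ Δ(0, 1, z), 0 < s, pw_z(q)·s² < Im z}`, `pw_z(q) = Im z·(q₀ − q₀² − q₁²) + (|z|² − Re z)·q₁`
(the last clause of `T(z)` reads `pw_z < Im z·t²`; put `s = 1/t`). The Jacobian identity
`t⁻³ = (1/t)·|−1/t²| = s·|det DΦ|` makes `[T(z), t⁻³] − [S(z), s]` ONE element of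
`KZ.changeOfVariablesRel` (Kontsevich–Zagier's rule (2)), and a representation `[S(z), s]` EXISTS:
`S(z) = Φ '' T(z)` is `ℚ`-semialgebraic by Tarski–Seidenberg
(`IsSemialgebraicMapOn.isSemialgebraic_image_holds`), `s` is a polynomial, and `s` is integrable on
`Φ '' T(z)` by Mathlib's change-of-variables criterion
`MeasureTheory.integrableOn_image_iff_integrableOn_abs_det_fderiv_smul` (the pulled-back integrand
`|det DΦ|·(Φ p)₂` IS `t⁻³ = r.integrand` on `T(z)`).

References: M. Kontsevich, D. Zagier, *Periods* (2001), §1.2 rule (2); J. Milnor, *Hyperbolic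
geometry: the first 150 years* (1982), Appendix; J. Bochnak, M. Coste, M.-F. Roy, *Real Algebraic
Geometry* (1998), §2.2 (Prop. 2.2.7).
-/

noncomputable section

open Set MeasureTheory MvPolynomial
open Literature.NumberTheory.Transcendental Literature.ModelTheory.ExponentialFields

namespace Summit.KontsevichZagierPeriods.HyperbolicBloch.OffTetraSectorKernel

/-- The coordinates of the height inversion `Φ(x, y, t) = (x, y, 1/t)`. [folklore] -/
theorem invert_apply (Φ : (Fin 3 → ℝ) → (Fin 3 → ℝ)) (hΦ : ∀ p, Φ p = ![p 0, p 1, 1 / p 2])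
    (p : Fin 3 → ℝ) : Φ p 0 = p 0 ∧ Φ p 1 = p 1 ∧ Φ p 2 = 1 / p 2 := by
  rw [hΦ]
  exact ⟨rfl, rfl, rfl⟩

/-- The height inversion is an involution of `ℝ³` (with Lean's convention `1 / 0 = 0`):
`Φ (Φ p) = p`. [folklore] -/
theorem invert_invert (Φ : (Fin 3 → ℝ) → (Fin 3 → ℝ)) (hΦ : ∀ p, Φ p = ![p 0, p 1, 1 / p 2])
    (p : Fin 3 → ℝ) : Φ (Φ p) = p := by
  obtain ⟨g0, g1, g2⟩ := invert_apply Φ hΦ (Φ p)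
  obtain ⟨h0, h1, h2⟩ := invert_apply Φ hΦ p
  rw [h0] at g0
  rw [h1] at g1
  rw [h2, one_div_one_div] at g2
  funext i
  fin_cases i
  exacts [g0, g1, g2]

/-- The height inversion is injective (an involution). [folklore] -/
theorem invert_injective (Φ : (Fin 3 → ℝ) → (Fin 3 → ℝ)) (hΦ : ∀ p, Φ p = ![p 0, p 1, 1 / p 2]) :
    Function.Injective Φ :=
  Function.LeftInverse.injective (g := Φ) (invert_invert Φ hΦ)

/-- The height inversion is a `ℚ`-semialgebraic map on every `ℚ`-semialgebraic `σ ⊆ {t > 0}`: its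
coordinates are the rational polynomials `X₀`, `X₁` and the quotient `1 / X₂` whose denominator
does not vanish on `σ`. [cite: BochnakCosteRoy1998, §2.2] -/
theorem invert_isSemialgebraicMapOn (Φ : (Fin 3 → ℝ) → (Fin 3 → ℝ))
    (hΦ : ∀ p, Φ p = ![p 0, p 1, 1 / p 2]) {σ : Set (Fin 3 → ℝ)} (hσ : IsSemialgebraic ℚ σ)
    (hpos : σ ⊆ {p | 0 < p 2}) : IsSemialgebraicMapOn ℚ σ Φ := by
  have hq0 : ∀ p ∈ σ, aeval p (X 2 : MvPolynomial (Fin 3) ℚ) ≠ 0 := fun p hp => by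
    have h2 : (0 : ℝ) < p 2 := hpos hp
    simpa using h2.ne'
  refine IsSemialgebraicMapOn.of_forall hσ fun j => ?_
  fin_cases j
  · exact (isSemialgebraicFunOn_aeval hσ (X 0)).congr fun p _ => by
      simp [(invert_apply Φ hΦ p).1]
  · exact (isSemialgebraicFunOn_aeval hσ (X 1)).congr fun p _ => by
      simp [(invert_apply Φ hΦ p).2.1]
  · exact (isSemialgebraicFunOn_aeval_div_aeval hσ 1 (X 2) hq0).congr fun p _ => by
      simp [(invert_apply Φ hΦ p).2.2]

/-- **The image of the ideal tetrahedron under the height inversion** is the inverted solid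
`S(z) = {q ∈ Δ(0,1,z), 0 < s, pw_z(q)·s² < Im z}`: the three triangle clauses are untouched,
`0 < 1/t`, and the hemisphere clause `0 < Im z·(x² + y² + t² − x) + (Re z − |z|²)·y`, i.e.
`pw_z < Im z·t²`, becomes `pw_z·s² < Im z` for `s = 1/t` (divide by `t² > 0`); surjectivity by the
involution. [cite: Milnor1982, Appendix (upper half-space model)] -/
theorem invert_image (Φ : (Fin 3 → ℝ) → (Fin 3 → ℝ)) (hΦ : ∀ p, Φ p = ![p 0, p 1, 1 / p 2])
    (z : ℂ) : Φ '' idealTetrahedron z = {p | 0 < p 1 ∧ z.re * p 1 < z.im * p 0 ∧ z.im * (p 0 - 1) < (z.re - 1) * p 1 ∧ 0 < p 2 ∧ (z.im * (p 0 - p 0 ^ 2 - p 1 ^ 2) + (Complex.normSq z - z.re) * p 1) * p 2 ^ 2 < z.im} := by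
  -- `Φ` maps `T(z)` into `S(z)`
  have key : ∀ p ∈ idealTetrahedron z, Φ p ∈ {p : Fin 3 → ℝ | 0 < p 1 ∧ z.re * p 1 < z.im * p 0 ∧
      z.im * (p 0 - 1) < (z.re - 1) * p 1 ∧ 0 < p 2 ∧
      (z.im * (p 0 - p 0 ^ 2 - p 1 ^ 2) + (Complex.normSq z - z.re) * p 1) * p 2 ^ 2 < z.im} := by
    intro p hp
    obtain ⟨h1, h2, h3, h4, h5⟩ := (mem_idealTetrahedron_iff z p).mp hp
    obtain ⟨e0, e1, e2⟩ := invert_apply Φ hΦ p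
    simp only [mem_setOf_eq, e0, e1, e2]
    refine ⟨h1, h2, h3, by positivity, ?_⟩
    have ht2 : 0 < p 2 ^ 2 := pow_pos h4 2
    rw [one_div, inv_pow, ← div_eq_mul_inv, div_lt_iff₀ ht2]
    have hid : z.im * p 2 ^ 2 - (z.im * (p 0 - p 0 ^ 2 - p 1 ^ 2) + (Complex.normSq z - z.re) * p 1)
        = z.im * (p 0 ^ 2 + p 1 ^ 2 + p 2 ^ 2 - p 0) + (z.re - Complex.normSq z) * p 1 := by ring
    linarith
  -- `Φ` maps `S(z)` into `T(z)`
  have key' : ∀ q ∈ {p : Fin 3 → ℝ | 0 < p 1 ∧ z.re * p 1 < z.im * p 0 ∧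
      z.im * (p 0 - 1) < (z.re - 1) * p 1 ∧ 0 < p 2 ∧
      (z.im * (p 0 - p 0 ^ 2 - p 1 ^ 2) + (Complex.normSq z - z.re) * p 1) * p 2 ^ 2 < z.im},
      Φ q ∈ idealTetrahedron z := by
    intro q hq
    obtain ⟨h1, h2, h3, h4, h5⟩ := hq
    obtain ⟨e0, e1, e2⟩ := invert_apply Φ hΦ q
    rw [mem_idealTetrahedron_iff, e0, e1, e2]
    refine ⟨h1, h2, h3, by positivity, ?_⟩
    have hs2 : 0 < q 2 ^ 2 := pow_pos h4 2
    have h6 : z.im * (q 0 - q 0 ^ 2 - q 1 ^ 2) + (Complex.normSq z - z.re) * q 1 < z.im / q 2 ^ 2 :=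
      (lt_div_iff₀ hs2).mpr h5
    have h7 : z.im / q 2 ^ 2 = z.im * (1 / q 2) ^ 2 := by
      rw [one_div, inv_pow, div_eq_mul_inv]
    have hid : z.im * (q 0 ^ 2 + q 1 ^ 2 + (1 / q 2) ^ 2 - q 0) + (z.re - Complex.normSq z) * q 1
        = z.im * (1 / q 2) ^ 2 -
          (z.im * (q 0 - q 0 ^ 2 - q 1 ^ 2) + (Complex.normSq z - z.re) * q 1) := by ring
    rw [hid, ← h7]
    linarith
  ext q
  constructor
  · rintro ⟨p, hp, rfl⟩
    exact key p hp
  · intro hq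
    exact ⟨Φ q, key' q hq, invert_invert Φ hΦ q⟩

/-- **The derivative of the height inversion and its determinant.** At a point with `t ≠ 0`, `Φ`
has the Fréchet derivative of matrix `diag(1, 1, −1/t²)`, of determinant `−1/t²`. [folklore] -/
theorem invert_hasFDerivAt_det (Φ : (Fin 3 → ℝ) → (Fin 3 → ℝ))
    (hΦ : ∀ p, Φ p = ![p 0, p 1, 1 / p 2]) {p : Fin 3 → ℝ} (hp : p 2 ≠ 0) :
    ∃ L : (Fin 3 → ℝ) →L[ℝ] (Fin 3 → ℝ), HasFDerivAt Φ L p ∧ L.det = -(p 2 ^ 2)⁻¹ := by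
  set M : Matrix (Fin 3) (Fin 3) ℝ := !![1, 0, 0; 0, 1, 0; 0, 0, -(p 2 ^ 2)⁻¹] with hM
  refine ⟨LinearMap.toContinuousLinearMap (Matrix.toLin' M), ?_, ?_⟩
  · -- derivative, componentwise
    have h0 : HasFDerivAt (fun x => Φ x 0)
        ((ContinuousLinearMap.proj 0).comp (LinearMap.toContinuousLinearMap (Matrix.toLin' M))) p := by
      have hf : (fun x => Φ x 0) = fun x : Fin 3 → ℝ => x 0 := by
        funext x
        exact (invert_apply Φ hΦ x).1
      rw [hf]
      refine (hasFDerivAt_apply (𝕜 := ℝ) (0 : Fin 3) p).congr_fderiv ?_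
      ext v
      simp [hM, Matrix.toLin'_apply, dotProduct, Fin.sum_univ_three]
    have h1 : HasFDerivAt (fun x => Φ x 1)
        ((ContinuousLinearMap.proj 1).comp (LinearMap.toContinuousLinearMap (Matrix.toLin' M))) p := by
      have hf : (fun x => Φ x 1) = fun x : Fin 3 → ℝ => x 1 := by
        funext x
        exact (invert_apply Φ hΦ x).2.1
      rw [hf]
      refine (hasFDerivAt_apply (𝕜 := ℝ) (1 : Fin 3) p).congr_fderiv ?_
      ext v
      simp [hM, Matrix.toLin'_apply, dotProduct, Fin.sum_univ_three]
    have h2 : HasFDerivAt (fun x => Φ x 2)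
        ((ContinuousLinearMap.proj 2).comp (LinearMap.toContinuousLinearMap (Matrix.toLin' M))) p := by
      have hf : (fun x => Φ x 2) = (fun y : ℝ => y⁻¹) ∘ fun x : Fin 3 → ℝ => x 2 := by
        funext x
        simp [(invert_apply Φ hΦ x).2.2]
      rw [hf]
      refine ((hasDerivAt_inv hp).comp_hasFDerivAt p
        (hasFDerivAt_apply (𝕜 := ℝ) (2 : Fin 3) p)).congr_fderiv ?_
      ext v
      simp [hM, Matrix.toLin'_apply, dotProduct, Fin.sum_univ_three]
    refine hasFDerivAt_pi'' fun i => ?_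
    fin_cases i
    exacts [h0, h1, h2]
  · -- determinant
    rw [LinearMap.det_toContinuousLinearMap, LinearMap.det_toLin', Matrix.det_fin_three]
    simp [hM]

/-- **Height-inversion move data on a representation `[σ, t⁻³]`, `σ ⊆ {t > 0}`**: a derivative
`Φ'` within `σ` at every point of `σ` together with the Jacobian identity
`t⁻³ = (Φ p)₂ · |det Φ' p|` (`= (1/t)·(1/t²)`). [cite: KontsevichZagier2001, §1.2 rule (2)] -/
theorem invert_moveData (Φ : (Fin 3 → ℝ) → (Fin 3 → ℝ)) (hΦ : ∀ p, Φ p = ![p 0, p 1, 1 / p 2])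
    {σ : Set (Fin 3 → ℝ)} (hpos : σ ⊆ {p | 0 < p 2}) :
    ∃ Φ' : (Fin 3 → ℝ) → ((Fin 3 → ℝ) →L[ℝ] (Fin 3 → ℝ)), ∀ x ∈ σ,
      HasFDerivWithinAt Φ (Φ' x) σ x ∧ 1 / x 2 ^ 3 = (Φ x) 2 * |(Φ' x).det| := by
  have hex : ∀ x : Fin 3 → ℝ, ∃ L : (Fin 3 → ℝ) →L[ℝ] (Fin 3 → ℝ),
      x 2 ≠ 0 → HasFDerivAt Φ L x ∧ L.det = -(x 2 ^ 2)⁻¹ := by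
    intro x
    by_cases hx : x 2 = 0
    · exact ⟨0, fun h => (h hx).elim⟩
    · obtain ⟨L, hL, hdet⟩ := invert_hasFDerivAt_det Φ hΦ hx
      exact ⟨L, fun _ => ⟨hL, hdet⟩⟩
  choose Φ' hΦ' using hex
  refine ⟨Φ', fun x hx => ?_⟩
  have hx2 : 0 < x 2 := hpos hx
  obtain ⟨hL, hdet⟩ := hΦ' x hx2.ne'
  refine ⟨hL.hasFDerivWithinAt, ?_⟩
  rw [hdet, (invert_apply Φ hΦ x).2.2, abs_neg, abs_of_pos (inv_pos.mpr (pow_pos hx2 2))]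
  field_simp

/-- **Inverting the height** (stub `stub_invert` of line `flat-shadow`; Kontsevich–Zagier's rule (2)
for `Φ(x, y, t) = (x, y, 1/t)` on `T(z) ⊆ {t > 0}`). For algebraic `z` with `Im z > 0` and every
representation `r = [T(z), t⁻³]`: a representation `[S(z), s]` on the inverted solid
`S(z) = Φ(T(z)) = {q ∈ Δ(0,1,z), 0 < s, pw_z(q)·s² < Im z}` with integrand `s` EXISTS (semialgebraic
image by Tarski–Seidenberg; `s` integrable on `Φ(T(z))` by the change-of-variables criterion, the
pulled-back integrand `|det DΦ|·(1/t) = t⁻³` being `r.integrand` on `T(z)`), and EVERY such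
representation `m` is KZ-equivalent to `r` by the single move `[r] − [m] ∈ changeOfVariablesRel`
(`Φ` semialgebraic, injective, derivative `diag(1, 1, −1/t²)`, `t⁻³ = s·|det DΦ|`).
[cite: KontsevichZagier2001, §1.2 rule (2)] -/
theorem stub_invert : ∀ (S : ℂ → Set (Fin 3 → ℝ)), (∀ z, S z = {p | 0 < p 1 ∧ z.re * p 1 < z.im * p 0 ∧ z.im * (p 0 - 1) < (z.re - 1) * p 1 ∧ 0 < p 2 ∧ (z.im * (p 0 - p 0 ^ 2 - p 1 ^ 2) + (Complex.normSq z - z.re) * p 1) * p 2 ^ 2 < z.im}) → ∀ z : ℂ, IsAlgebraic ℚ z → 0 < z.im → ∀ r : Literature.NumberTheory.Transcendental.KZ.IntegralRep 3, r.domain = Literature.NumberTheory.Transcendental.idealTetrahedron z → Set.EqOn r.integrand (fun p => 1 / p 2 ^ 3) r.domain → (∃ m : Literature.NumberTheory.Transcendental.KZ.IntegralRep 3, m.domain = S z ∧ Set.EqOn m.integrand (fun p => p 2) m.domain) ∧ (∀ m : Literature.NumberTheory.Transcendental.KZ.IntegralRep 3, m.domain = S z → Set.EqOn m.integrand (fun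 p => p 2) m.domain → Literature.NumberTheory.Transcendental.KZ.Equivalent r m) := by
  intro S hS z _ _ r hr hri
  -- the move `Φ(x, y, t) = (x, y, 1/t)`
  set Φ : (Fin 3 → ℝ) → (Fin 3 → ℝ) := fun p => ![p 0, p 1, 1 / p 2] with hΦdef
  have hΦ : ∀ p, Φ p = ![p 0, p 1, 1 / p 2] := fun _ => rfl
  -- `T(z) ⊆ {t > 0}`
  have hpos : r.domain ⊆ {p | 0 < p 2} := fun p hp =>
    pos_of_mem_idealTetrahedron (z := z) (by rw [← hr]; exact hp)
  -- the image is `S(z)`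
  have himage : Φ '' r.domain = S z := by
    rw [hr, hS]
    exact invert_image Φ hΦ z
  -- the four data of the move
  have hΦsa : IsSemialgebraicMapOn ℚ r.domain Φ :=
    invert_isSemialgebraicMapOn Φ hΦ r.isSemialgebraic_domain hpos
  have hinj : InjOn Φ r.domain := (invert_injective Φ hΦ).injOn
  obtain ⟨Φ', hΦ'⟩ := invert_moveData Φ hΦ hpos
  have hmeas : MeasurableSet r.domain := KZ.IntegralRep.measurableSet_domain_holds r
  -- EXISTENCE of `[S(z), s]`: semialgebraic image, polynomial integrand, change of variables
  have hT : IsSemialgebraic ℚ (Φ '' r.domain) :=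
    IsSemialgebraicMapOn.isSemialgebraic_image_holds hΦsa subset_rfl r.isSemialgebraic_domain
  have hF : IsSemialgebraicFunOn ℚ (Φ '' r.domain) (fun p : Fin 3 → ℝ => p 2) :=
    (isSemialgebraicFunOn_aeval hT (X 2)).congr fun p _ => by simp
  have hI : IntegrableOn (fun p : Fin 3 → ℝ => p 2) (Φ '' r.domain) := by
    rw [integrableOn_image_iff_integrableOn_abs_det_fderiv_smul volume hmeas
      (fun x hx => (hΦ' x hx).1) hinj]
    refine r.integrableOn.congr_fun (fun x hx => ?_) hmeas
    calc r.integrand x = 1 / x 2 ^ 3 := hri hx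
      _ = (Φ x) 2 * |(Φ' x).det| := (hΦ' x hx).2
      _ = |(Φ' x).det| • (Φ x) 2 := by rw [smul_eq_mul, mul_comm]
  refine ⟨⟨⟨Φ '' r.domain, fun p => p 2, hT, hF, hI⟩, himage, fun _ _ => rfl⟩, ?_⟩
  -- EVERY `[S(z), s]` is one change-of-variables move away from `r`
  intro m hm hmi
  refine KZ.changeOfVariablesRel_subset_relations
    ⟨3, r, m, Φ, Φ', hΦsa, fun x hx => (hΦ' x hx).1, hinj, hm.trans himage.symm, fun x hx => ?_, rfl⟩
  have hx' : Φ x ∈ m.domain := by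
    rw [hm, ← himage]
    exact mem_image_of_mem Φ hx
  have h2 : m.integrand (Φ x) = (Φ x) 2 := hmi hx'
  calc r.integrand x = 1 / x 2 ^ 3 := hri hx
    _ = (Φ x) 2 * |(Φ' x).det| := (hΦ' x hx).2
    _ = m.integrand (Φ x) * |(Φ' x).det| := by rw [h2]

end Summit.KontsevichZagierPeriods.HyperbolicBloch.OffTetraSectorKernel

end
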